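import Summits.CriticalPhenomena.SAWScalingLimit.Theorems.AnnularMassDecay.Negative.Structure
import Literature.Probability.LatticeModels.ThermodynamicLimit

/-!
# Crux `SAWRenewalTightness.AnnularMassDecay` (stmt-CriticalPhenomena-4729): objects of the line `last-renewal-delocalization`

Definitions (objects only — no statement is asserted or proved here) used by the positive-side files of this crux, i.e.
by the registered stubs of the checked skeleton
`Summits/CriticalPhenomena/SAWScalingLimit/Cruxes/AnnularMassDecay/Lines/last_renewal_delocalization.lean`
(strategist `planner-cstrat-stmt-CriticalPhenomena-4729-p1-0`, lead `prover-line-stmt-CriticalPhenomena-4729-c3-0`,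
`ledger skeleton check` 2026-08-17) and by its composition theorem `AnnularMassDecay_of`.  They are verbatim the
vocabulary block of that skeleton, moved here so that landed stub files can share it:

* `ht e u x` — the height `⟨x - u, e⟩` of a lattice point in the frame at `u` with real unit direction `e ∈ ℂ ≅ ℝ²`;
* `IsBr e u m β` — `β` (an `m`-step walk from `0`, positions `u + β i`) is an `e`-BRIDGE from `u`: strictly positive
  heights after time `0`, endpoint of (weakly) maximal height (Madras–Slade Def. 1.2.4, in a real direction);
* `IsRen e u p m s` — `s` is an `e`-RENEWAL TIME of the positions `p 0, …, p m`: past weakly below `p s`, future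
  strictly above (Duminil-Copin–Hammond 2013 §2.3; the "cut times" of Dyhr–Gilbert–Kennedy–Lawler–Passon 2011 §2);
* `IsIrr e m β` — irreducible `e`-bridge from `0`: `m > 0`, a bridge, no renewal time in `[1, m-1]` (Kesten 1963);
* `brMass e u x N` — `b_N(u → u+x)`, the `x_c`-mass of `e`-bridges from `u` of length `≤ N` with endpoint offset `x`;
* `irrTail e t N` — `p̄_N(t)`, the `x_c`-mass of irreducible `e`-bridges from `0` of length `≤ N` and span `≥ t`;
* `frameDir z u`, `botLevel z r u` — the crux frame `e = (z-u)/|z-u|` and the level `ℓ = |z-u| - r` of the bottom of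
  the target disc;
* `pfxMass z r R u x N` — `N°_N(u+x)`, the `x_c`-mass of the LAST EXCURSIONS: walks from `v = u+x` (`h(v) < ℓ`) living
  strictly above `h(v)`, with no `e`-renewal at a height `< ℓ`, interior vertices in the open annulus
  `r < |· - z| < R`, endpoint in `|· - z| ≤ r`.

All sums are over tree vocabulary (`SAW.Zd.saws`, `SAW.criticalFugacity`, `Site.toComplex`, `annMass`, `box`).
Sources: H. Kesten, J. Math. Phys. 4 (1963) §4; N. Madras, G. Slade, *The Self-Avoiding Walk* (1993) §1.2, §4.2;
B. Dyhr, M. Gilbert, T. Kennedy, G. F. Lawler, S. Passon, J. Stat. Phys. 144 (2011), arXiv:1008.4321 §2;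
H. Duminil-Copin, A. Hammond, Comm. Math. Phys. 324 (2013), arXiv:1205.0401 §2.3.  After the definitions, a short
block of elementary facts shared by the stub files (additivity / translation invariance of heights, `IsBr`, `IsRen`,
nonnegativity, and the registered sub-goal `lr_pfxMass_eq_zero_of_le`).  Deliberately NOT here: the stub statements of
the line (they live, with their status, in the skeleton) and anything with mathematical content.
-/

noncomputable section

namespace Summit.CriticalPhenomena.SAWScalingLimit.Theorems.AnnularMassDecay.LastRenewal

open scoped BigOperators Classical ComplexConjugate
open Literature.Probability.LatticeModels Literature.Probability.RandomPlanarGeometry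
open Summit.CriticalPhenomena.SAWScalingLimit.Theorems.AnnularMassDecay.Negative (criticalFugacity_pos)

/-- Height of the lattice point `x` in the frame at `u` with (unit) direction `e ∈ ℂ ≅ ℝ²`:
`h_{u,e}(x) = Re((x - u)·ē) = ⟨x - u, e⟩`. [cite: MadrasSlade1993, §1.2, Definition 1.2.4] -/
def ht (e : ℂ) (u x : Site 2) : ℝ := ((Site.toComplex x - Site.toComplex u) * conj e).re

/-- `β` (its first `m` steps, `β 0 = 0`, positions `u + β i`) is an `e`-BRIDGE from `u` (Madras–Slade Def. 1.2.4 in the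
real direction `e`): after time `0` every vertex has strictly positive height, and the endpoint has (weakly) maximal
height. [cite: MadrasSlade1993, §1.2, Definition 1.2.4] -/
def IsBr (e : ℂ) (u : Site 2) (m : ℕ) (β : ℕ → Site 2) : Prop :=
  (∀ i, 1 ≤ i → i ≤ m → 0 < ht e u (u + β i)) ∧ (∀ i, i ≤ m → ht e u (u + β i) ≤ ht e u (u + β m))

/-- `s` is an `e`-RENEWAL TIME of the finite walk with positions `p 0, …, p m` (frame at `u`): the past is weakly
below `p s` and the future (up to time `m`) is strictly above it (Duminil-Copin–Hammond 2013 §2.3; the "cut times" of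
Dyhr–Gilbert–Kennedy–Lawler–Passon 2011 §2). [cite: DuminilCopinHammond2013, §2.3] -/
def IsRen (e : ℂ) (u : Site 2) (p : ℕ → Site 2) (m s : ℕ) : Prop :=
  (∀ i, i < s → ht e u (p i) ≤ ht e u (p s)) ∧ (∀ j, s < j → j ≤ m → ht e u (p s) < ht e u (p j))

/-- `β` (first `m` steps) is an IRREDUCIBLE `e`-bridge from `0`: a bridge with `m > 0` and no renewal time in
`[1, m-1]` (Kesten 1963; Madras–Slade Def. 4.2.1; real direction). [cite: MadrasSlade1993, §4.2, Definition 4.2.1] -/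
def IsIrr (e : ℂ) (m : ℕ) (β : ℕ → Site 2) : Prop :=
  0 < m ∧ IsBr e 0 m β ∧ ∀ s, 1 ≤ s → s < m → ¬ IsRen e 0 (fun i => (0 : Site 2) + β i) m s

/-- `b_N(u → u + x)`: the `x_c`-mass of the `e`-bridges from `u` of length `≤ N` with endpoint offset `x`
(endpoint `u + x`). [cite: MadrasSlade1993, §1.2, eq. (1.2.13)] -/
def brMass (e : ℂ) (u x : Site 2) (N : ℕ) : ℝ :=
  ∑ m ∈ Finset.range (N + 1),
    ∑ _β ∈ (SAW.Zd.saws 2 m).filter (fun β => IsBr e u m β ∧ β m = x), SAW.criticalFugacity ^ m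

/-- `p̄_N(t)`: the `x_c`-mass of the irreducible `e`-bridges from `0` of length `≤ N` and span `≥ t` — partial sums
of Kesten's `P(span ≥ t)` (`≤ A^e(x_c) ≤ 1` by Kraft; `= P_K(span ≥ t)` for lattice directions, where `A(x_c) = 1`,
Madras–Slade (4.2.4)). [cite: MadrasSlade1993, §4.2, eq. (4.2.4)] -/
def irrTail (e : ℂ) (t : ℝ) (N : ℕ) : ℝ :=
  ∑ m ∈ Finset.range (N + 1),
    ∑ _β ∈ (SAW.Zd.saws 2 m).filter (fun β => IsIrr e m β ∧ t ≤ ht e 0 (β m)), SAW.criticalFugacity ^ m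

/-- The crux frame: the unit direction from the start `u` towards the centre `z`, `e = (z - u)/|z - u|`
(junk value `0` when `z = u`, never used: the crux has `|u - z| ≥ R > 1`). [folklore] -/
def frameDir (z : ℂ) (u : Site 2) : ℂ := (z - Site.toComplex u) / ((dist (Site.toComplex u) z : ℝ) : ℂ)

/-- The level of the bottom of the target disc in the crux frame: `ℓ = |z - u| - r`. [folklore] -/
def botLevel (z : ℂ) (r : ℝ) (u : Site 2) : ℝ := dist (Site.toComplex u) z - r

/-- `N°_N(v)`, `v = u + x`: the `x_c`-mass of the LAST EXCURSIONS — walks `η` of length `≤ N` from a point `v` with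
`h(v) < ℓ`, living strictly above `h(v)`, with NO `e`-renewal time at a height `< ℓ`, interior vertices in the open
annulus `r < |· - z| < R`, endpoint in `|· - z| ≤ r` (hence first entry); frame `e = frameDir z u`, level
`ℓ = botLevel z r u`.  These are exactly the suffixes of the crux's annular bridges after their last renewal strictly
below `ℓ` (the "bridge irreducible above height `ℓ`" cut of Dyhr–Gilbert–Kennedy–Lawler–Passon 2011 §2, taken at the
level of the disc). [cite: DyhrGilbertKennedyLawlerPasson2011, §2] -/
def pfxMass (z : ℂ) (r R : ℝ) (u x : Site 2) (N : ℕ) : ℝ :=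
  ∑ m ∈ Finset.range (N + 1),
    ∑ _η ∈ (SAW.Zd.saws 2 m).filter (fun η =>
      ht (frameDir z u) u (u + x) < botLevel z r u ∧
      (∀ s, 1 ≤ s → s ≤ m → ht (frameDir z u) u (u + x) < ht (frameDir z u) u (u + x + η s)) ∧
      (∀ s, 1 ≤ s → s ≤ m → ht (frameDir z u) u (u + x + η s) < botLevel z r u →
        ¬ IsRen (frameDir z u) u (fun i => u + x + η i) m s) ∧
      (∀ s, 1 ≤ s → s < m →
        r < dist (Site.toComplex (u + x + η s)) z ∧ dist (Site.toComplex (u + x + η s)) z < R) ∧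
      dist (Site.toComplex (u + x + η m)) z ≤ r),
      SAW.criticalFugacity ^ m

/-! ## Elementary facts about the vocabulary (shared by the stub files; no stub statement is asserted) -/

/-- Heights are differences of the linear height functional based at `0`: `h_{u,e}(x) = h_{0,e}(x) - h_{0,e}(u)`.
[folklore] -/
theorem ht_eq_sub (e : ℂ) (u x : Site 2) : ht e u x = ht e 0 x - ht e 0 u := by
  simp only [ht, Complex.mul_re, Complex.sub_re, Complex.sub_im, Complex.conj_re, Complex.conj_im,
    Site.toComplex_re, Site.toComplex_im, Pi.zero_apply, Int.cast_zero, sub_zero]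
  ring

/-- The height functional based at `0` is additive. [folklore] -/
theorem ht_zero_add (e : ℂ) (x y : Site 2) : ht e 0 (x + y) = ht e 0 x + ht e 0 y := by
  simp only [ht, Complex.mul_re, Complex.sub_re, Complex.sub_im, Complex.conj_re, Complex.conj_im,
    Site.toComplex_re, Site.toComplex_im, Pi.zero_apply, Pi.add_apply, Int.cast_zero, Int.cast_add, sub_zero]
  ring

/-- The base point has height `0`. [folklore] -/
theorem ht_self (e : ℂ) (u : Site 2) : ht e u u = 0 := by
  simp only [ht, sub_self, zero_mul, Complex.zero_re]

/-- Translating the point by `y` adds `h_{0,e}(y)`: `h_{u,e}(x + y) = h_{u,e}(x) + h_{0,e}(y)` (the workhorse for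
`u + x + η s`). [folklore] -/
theorem ht_add_right (e : ℂ) (u x y : Site 2) : ht e u (x + y) = ht e u x + ht e 0 y := by
  rw [ht_eq_sub e u (x + y), ht_eq_sub e u x, ht_zero_add]
  ring

/-- In particular `h_{u,e}(u + y) = h_{0,e}(y)`: heights in the frame at `u` only see offsets. [folklore] -/
theorem ht_base_add (e : ℂ) (u y : Site 2) : ht e u (u + y) = ht e 0 y := by
  rw [ht_add_right, ht_self, zero_add]

/-- Being an `e`-bridge does not depend on the base point (translation only, no reflection). [folklore] -/
theorem isBr_iff_zero (e : ℂ) (u : Site 2) (m : ℕ) (β : ℕ → Site 2) : IsBr e u m β ↔ IsBr e 0 m β := by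
  simp only [IsBr, ht_base_add]

/-- Renewal times only compare heights among the positions, so translating all positions by `w` (and changing the
base point) changes nothing. [folklore] -/
theorem isRen_translate (e : ℂ) (u w : Site 2) (p : ℕ → Site 2) (m s : ℕ) :
    IsRen e u (fun i => w + p i) m s ↔ IsRen e 0 p m s := by
  simp only [IsRen, ht_add_right e u w, add_le_add_iff_left, add_lt_add_iff_left]

/-- Bridge masses do not depend on the base point. [folklore] -/
theorem brMass_eq_zero_base (e : ℂ) (u x : Site 2) (N : ℕ) : brMass e u x N = brMass e 0 x N := by
  unfold brMass
  simp only [isBr_iff_zero e u]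

/-- Bridge masses are nonnegative. [folklore] -/
theorem brMass_nonneg (e : ℂ) (u x : Site 2) (N : ℕ) : 0 ≤ brMass e u x N :=
  Finset.sum_nonneg fun m _ => Finset.sum_nonneg fun _ _ => pow_nonneg criticalFugacity_pos.le m

/-- Span tails are nonnegative. [folklore] -/
theorem irrTail_nonneg (e : ℂ) (t : ℝ) (N : ℕ) : 0 ≤ irrTail e t N :=
  Finset.sum_nonneg fun m _ => Finset.sum_nonneg fun _ _ => pow_nonneg criticalFugacity_pos.le m

/-- Last-excursion masses are nonnegative. [folklore] -/
theorem pfxMass_nonneg (z : ℂ) (r R : ℝ) (u x : Site 2) (N : ℕ) : 0 ≤ pfxMass z r R u x N :=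
  Finset.sum_nonneg fun m _ => Finset.sum_nonneg fun _ _ => pow_nonneg criticalFugacity_pos.le m

/-- No last excursion starts at or above the disc level `ℓ` (the first clause of the family `pfxMass`).
Registered sub-goal `lr_pfxMass_eq_zero_of_le` of stmt-CriticalPhenomena-4729 (used by `AnnularMassDecay_of` to
discard cut points at heights `≥ ℓ`). [folklore] -/
theorem lr_pfxMass_eq_zero_of_le : ∀ (z : ℂ) (r R : ℝ) (u x : Site 2) (N : ℕ), botLevel z r u ≤ ht (frameDir z u) u (u + x) → pfxMass z r R u x N = 0 := by
  intro z r R u x N h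
  unfold pfxMass
  refine Finset.sum_eq_zero fun m _ => Finset.sum_eq_zero fun η hη => ?_
  simp only [Finset.mem_filter] at hη
  exact absurd hη.2.1 (not_lt.2 h)

/-! ## Iterated concatenation of blocks (vocabulary of S2b `stub_bridgeCodeCount`) -/

/-- Iterated concatenation of a list of blocks `(n, w)` (each meant to be an `n`-step walk from `0`): the total length and
the walk `w₁ ⊕ (w₂ ⊕ ⋯)`, each piece translated to start where the previous one ends (`SAW.Zd.concatWalk`); the empty
list gives the trivial walk `(0, 0)`. [cite: MadrasSlade1993, §1.2, eq. (1.2.15)] -/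
def catBlocks : List (ℕ × (ℕ → Site 2)) → ℕ × (ℕ → Site 2)
  | [] => (0, fun _ => 0)
  | b :: L => (b.1 + (catBlocks L).1, SAW.Zd.concatWalk b.1 b.2 (catBlocks L).2)

/-- `catBlocks [] = (0, 0)`. [folklore] -/
@[simp] theorem catBlocks_nil : catBlocks [] = (0, fun _ => (0 : Site 2)) := rfl

/-- `catBlocks (b :: L) = (n_b + |L|, w_b ⊕ catBlocks L)`. [folklore] -/
@[simp] theorem catBlocks_cons (b : ℕ × (ℕ → Site 2)) (L : List (ℕ × (ℕ → Site 2))) :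
    catBlocks (b :: L) = (b.1 + (catBlocks L).1, SAW.Zd.concatWalk b.1 b.2 (catBlocks L).2) := rfl

/-- The total length of `catBlocks L` is the sum of the block lengths (registered sub-goal `lr_catBlocks_fst` of
stmt-CriticalPhenomena-4729). [folklore] -/
theorem lr_catBlocks_fst : ∀ (L : List (ℕ × (ℕ → Site 2))), (catBlocks L).1 = (L.map Prod.fst).sum := by
  intro L
  induction L with
  | nil => rfl
  | cons b L ih => simp [ih]

end Summit.CriticalPhenomena.SAWScalingLimit.Theorems.AnnularMassDecay.LastRenewal

end
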